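import Literature.MathematicalPhysics.QuantumFieldTheory.Balaban1983to89.B9Eq370Expansion

/-!
# `Balaban1983to89.B9Eq352ScalarFluct` — B9, pp. 400–401, (3.50)–(3.54): the SCALAR side of Sect. B — the covariant
# Laplace operator `Δ_U` of (3.23) on 𝔤-valued site functions `λ`, its star form (3.50), the fluctuation operator `V′₁(A)` of
# (3.51)–(3.53) with `Δ_{U′U} = Δ_U − V′₁(A)` as an EXACT identity, and the local bound (3.54) with every `O(1)` explicit;
# kernel-checked; v1.1 (helper docstrings carry their locus)

statement-level skeleton of published theorems with citation tags; proofs where landed; nothing here is a claim about the Yang–Mills mass gap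

CITATION HEADER (lean-in-tree rule).  Cell `lit-balaban` (mega-formalization of Bałaban CMP 1983–89), reader/typer seat
`lit-balaban-r06` (SKELETON rows B9-D3.23, B9-D3.50, B9-L3.54 of `run/shared/lean/pub/lit-balaban/lit-balaban-r06/SKELETON-r06.md`).
Source: T. Bałaban, *Propagators for lattice gauge theories in a background field*, Commun. Math. Phys. **99** (1985) 389–434,
doi:10.1007/bf01240355 [Balaban1985BackgroundPropagators] (cell paper B9; held `paper:balaban1985-cmp99-background-propagators`;
journal page = PDF page + 388), p. 394 [PDF 6] (3.23), p. 400 [PDF 12] (3.50)–(3.53), p. 401 [PDF 13] (3.54), read from the page renders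
`run/shared/lean/pub/pub-balaban/b2b-balaban-ref1/pages/1985-cmp99-background-propagators/…-p006-x2.png`, `…-p012-x2.png`,
`…-p013-x2.png` (the text layer garbles the displays).  This module is the scalar (`λ` site-valued) SIBLING of the tree's vector-side
modules `…B9Eq370Expansion` ((3.70), (3.74): the per-transport expansions, imported and used BY NAME — `covD_prodCfg`, `R_fluct`,
`R_inv_prodCfg`, `R_conj_exp`, `conjRem`, `conj_eq_expand`, `norm_conjRem_le_sq`, `norm_Iη_smul`, `R_Iη_smul`) and
`…B9Eq371Composition` ((3.71)–(3.73)); nothing of theirs is restated.  The lattice vocabulary is `…B9Eq39Adjoint`'s (`R`, `covD`,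
`covDstar`, `divB`, `fluct`, `prodCfg`: sites `S`, directions `ι`, shifts `T μ : S ≃ S`, bond units `U μ x = U(x, x+e_μ)`, `η`-FREE
differences `D¹ = ηD`, `D¹* = ηD*`).

WHAT IS IN PRINT (verbatim; «…»).  p. 394: «The operator Δ^η_U↾Ω₀ is the covariant Laplace operator with Dirichlet boundary
conditions, i.e. Δ^η_U = D^{η*}_U D^η_U and the operator is restricted to functions defined on the subset Ω₀. (3.23)».  p. 400:
«Let us start with the covariant Laplace operator Δ_U given by (3.23). We have
(Δ_{U′U}λ)(x) = η⁻²(2dλ(x) − Σ_{b∈st(x)} R((U′U)_b)λ(b₊))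
 = η⁻²(2dλ(x) − Σ_{μ=1}^d R(U′(x, x+ηe_μ))R(U(x, x+ηe_μ))λ(x+ηe_μ) − Σ_{μ=1}^d R(U(x, x−ηe_μ))R(U′(x, x−ηe_μ))λ(x−ηe_μ))
 = η⁻²(2dλ(x) − Σ_{b∈st(x)} exp iηad_{A′(b)}R(U_b)λ(b₊)), (3.50)
where A′(b) = A(b) for positively oriented bonds b, and A′(b) = R(U_b)A(b) for negatively oriented b. Expanding the exponential
above we get (Δ_{U′U}λ)(x) = (Δ_Uλ)(x) − η⁻¹ Σ_{b∈st(x)} iad_{A′(b)}R(U_b)λ(b₊) − Σ_{b∈st(x)} F′_{1,k}(iad_{A′(b)})λ(b₊)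
 = (Δ_Uλ)(x) − Σ_{b∈st(x)} iad_{A′(b)}(D_Uλ)(b) − i[(D*_U A)(x), λ(x)] − Σ_{b∈st(x)} F′_{1,k}(iad_{A′(b)})λ(b₊), (3.51)
where F′_{1,k}(z) = η⁻²(e^{ηz} − 1 − ηz) = z²∫₀¹dt(1−t)e^{ηtz}, hence F′_{1,k}(iad_{A′(b)}) is an analytic function of A(b). Let us
denote the first order operator on the right-hand side above by V′₁(A), thus
(V′₁(A)λ)(x) = Σ_{b∈st(x)} i[A′(b), (D_Uλ)(b)] + i[(D*_U A)(x), λ(x)] + Σ_{b∈st(x)} F′_{1,k}(iad_{A′(b)})λ(b₊), (3.52)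
and Δ_{U′U} = Δ_U − V′₁(A). (3.53)».  p. 401: «We assume that A satisfies (3.37), hence for x ∈ Ω_j
|(V′₁(A)λ)(x)| ≤ 4dα₁(L^jη)⁻¹|∇_Uλ| + 2dα₁(L^jη)⁻²|λ| + 8dα₁²(L^jη)⁻²|λ|, (3.54)
the norms on the right-hand side involve only nearest neighbours of x because V′₁ is local.»

WHAT IS REPRODUCED (kernel-checked, every `O(1)` explicit).
* §1 `siteLap` — the covariant Laplacian (3.23) on site functions, `(Δ_Uλ)(x) = η⁻² Σ_μ (D¹*_μ D¹_μ λ)(x)` in `…B9Eq39Adjoint`'s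
  `η`-free differences; **`siteLap_eq_star`** — the FIRST line of (3.50) for an ARBITRARY configuration `V`:
  `(Δ_Vλ)(x) = η⁻² Σ_μ (2λ(x) − R(V(x,x+e_μ))λ(x+e_μ) − R(V(x,x−e_μ))λ(x−e_μ))` (`R(V(x,x−e_μ)) = R(V_μ(x−e_μ))⁻¹` by (3.5));
  **`siteLap_prodCfg`** — the LAST line of (3.50) for `U′U`: the forward transport is `e^{b}·R(U_μ(x))λ(x+e_μ)·e^{−b}`,
  `b = iηA_μ(x)` (`= exp iηad_{A′(b)}R(U_b)λ(b₊)`), the backward one `e^{−a′}·R(U_μ(y))⁻¹λ(y)·e^{a′}`, `y = x − e_μ`,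
  `a′ = R(U_μ(y))⁻¹(iηA_μ(y))` (`= exp iηad_{A′(b)}R(U_b)λ(b₊)` with `A′(b) = R(U_b)A(b)`, `A(b) = −A_μ(y)` by (3.5)).
* §2 `V1p` — the operator `V′₁(A)` DEFINED BY (3.53) (`Δ_{U′U} = Δ_U − V′₁(A)`), written out per direction through the
  first-order vertex `ad` and the remainder `𝓕 = conjRem` of `…B9Eq370Expansion` («F′_{1,k}(iad_{A′(b)})λ(b₊)» IS
  `η⁻²·𝓕(iηA′(b), R(U_b)λ(b₊))`: `Fp1`, `Fp1_eq`); **`eq353`** — (3.53), EXACT; **`V1p_eq_firstOrder`** — the regrouping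
  (3.50) → (3.51)/(3.52) of the first-order part into `Σ_{b∈st(x)} i[A′(b), (D_Uλ)(b)]` and ONE commutator with `(D*_U A)(x)`
  (`D*` = (3.8) = `η⁻¹·divB`), EXACT for `η ≠ 0`.
  READING NOTE (located, not adjudicated): with `D*` as printed in (3.8) (`(D*A)(x) = Σ_μ η⁻¹(R(U(x,x−ηe_μ))A(x−ηe_μ,x) −
  A(x,x+ηe_μ))`, i.e. minus the covariant divergence) the kernel-checked regrouping carries the middle term with the sign
  `− i[(D*_U A)(x), λ(x)]` inside `V′₁(A)` where (3.52) prints `+ i[(D*_U A)(x), λ(x)]` (equivalently (3.51) prints `− i[…]`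
  where the identity has `+`).  The discrepancy is a sign convention/print slip confined to this commutator; it is invisible in
  (3.54) and in everything downstream, which use only its absolute value.  Recorded for the cell's census; the theorem states
  what the kernel proves.
* §3 **`norm_V1p_le`** — (3.54) with explicit constants from LOCAL hypotheses at the star of `x` (the letters exactly as they
  occur: `|A′(b)| ≤ a`, `|(D_Uλ)(b)| ≤ Λ₁` on the `2d` bonds of `st(x)`, `|(D*_U A)(x)| ≤ g`, the transported values of `λ` at the
  neighbours and `λ(x)` bounded by `Λ₀`): `‖(V′₁(A)λ)(x)‖ ≤ 4d·a·Λ₁ + 2·g·Λ₀ + 4d·a²e^{2ηa}·Λ₀`; **`norm_V1p_le_printed`** —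
  the printed shape: with `a = α₁(L^jη)⁻¹` ((3.37): `|A| < α₁(L^jη)⁻¹`), `g ≤ d·α₁(L^jη)⁻²` (from `|∇^η_U A| < α₁(L^jη)⁻²`: `D*A`
  is a sum of `d` covariant derivatives of `A`) and `e^{2α₁L^{−j}} ≤ 2` («for α₁ sufficiently small»; `exp_two_mul_le_two`:
  `α₁L^{−j} ≤ 1/4` suffices) one gets EXACTLY `4dα₁(L^jη)⁻¹Λ₁ + 2dα₁(L^jη)⁻²Λ₀ + 8dα₁²(L^jη)⁻²Λ₀`.
WHAT IS *NOT* REPRODUCED: the domain geometry (`Ω_j`, Dirichlet restriction to `Ω₀` — `siteLap` is the whole-lattice operator;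
the restriction is a compression, as in `…B9Thm37GlueTorusInv`); (3.55)–(3.61) (the averaging side `F′_{2,j}`, `V′`, which rest on
[5] = CMP 98 (52), (53), (97), (102), (103), (160)–(162), Prop. 4 — SKELETON rows B9-L3.55/3.58/3.60, absent); any statement in the
normalised Hilbert–Schmidt norm of p. 390 (all bounds are in the abstract `NormedRing` norm; for a unitary background in an
operator norm the transports are isometric and the transported letters have the sizes of the untransported ones — cell
DIVERGENCE D-r1.1).  NOT summit progress; NOT a claim about any disputed step of the series.
-/

namespace Literature.MathematicalPhysics.QuantumFieldTheory.Balaban1983to89.B9Eq352ScalarFluct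

open NormedSpace Complex
open Literature.MathematicalPhysics.QuantumFieldTheory.Balaban1983to89
open Literature.MathematicalPhysics.QuantumFieldTheory.Balaban1983to89.Beta.BackgroundVertices (ad norm_ad_le ad_smul_left
  ad_smul_right ad_add_right ad_sub_right ad_add_left ad_sub_left ad_neg_left)
open Literature.MathematicalPhysics.QuantumFieldTheory.Balaban1983to89.B9Eq39Adjoint
open Literature.MathematicalPhysics.QuantumFieldTheory.Balaban1983to89.B9Eq369Product
open Literature.MathematicalPhysics.QuantumFieldTheory.Balaban1983to89.B9Eq370Expansion

/-! ## §1  The covariant Laplacian (3.23) on site functions and its star form (3.50) -/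

section SiteLap

variable {𝔸 : Type*} [Ring 𝔸] [Algebra ℂ 𝔸] {S : Type*} {ι : Type*} [Fintype ι]
variable (T : ι → Equiv.Perm S) (U : ι → S → 𝔸ˣ)

/-- **(3.23)**, the covariant Laplace operator on 𝔤-valued SITE functions: `(Δ^η_U λ)(x) = (D^{η*}_U D^η_U λ)(x)
= η⁻² Σ_μ (D¹*_μ D¹_μ λ)(x)` with the `η`-free differences `D¹ = covD`, `D¹* = covDstar` of `…B9Eq39Adjoint` ((3.3), (3.8));
the whole-lattice operator (the Dirichlet restriction to `Ω₀` is a compression and is not modelled here).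
[cite: Balaban1985BackgroundPropagators, (3.23) p.394, (3.50) p.400] -/
noncomputable def siteLap (η : ℝ) (lam : S → 𝔸) (x : S) : 𝔸 :=
  (((η : ℂ)⁻¹) ^ 2) • ∑ μ, covDstar T U μ (covD T U μ lam) x

/-- **(3.50), FIRST LINE**, for an arbitrary configuration `V`: `(Δ_Vλ)(x) = η⁻²(2dλ(x) − Σ_{b∈st(x)} R(V_b)λ(b₊))`, the star
`st(x)` organised by direction — forward bond `⟨x, x+e_μ⟩` with transport `R(V_μ(x))`, backward bond `⟨x, x−e_μ⟩` with transport
`R(V(x, x−e_μ)) = R(V_μ(x−e_μ))⁻¹` ((3.5)).  [cite: Balaban1985BackgroundPropagators, (3.50) p.400, (3.5) p.391] -/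
theorem siteLap_eq_star (η : ℝ) (V : ι → S → 𝔸ˣ) (lam : S → 𝔸) (x : S) :
    siteLap T V η lam x
      = (((η : ℂ)⁻¹) ^ 2) • ∑ μ, (2 • lam x - R (V μ x) (lam (T μ x))
          - R (V μ ((T μ).symm x))⁻¹ (lam ((T μ).symm x))) := by
  simp only [siteLap, covDstar, covD, Equiv.apply_symm_apply, R_sub, R_inv_R]
  congr 1
  refine Finset.sum_congr rfl fun μ _ => ?_
  rw [two_smul]
  abel

end SiteLap

/-! ## §2  (3.50) for `U′U`, the operator `V′₁(A)` and (3.53) -/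

section Fluct

variable {𝔸 : Type*} [NormedRing 𝔸] [NormedAlgebra ℂ 𝔸] [CompleteSpace 𝔸] {S : Type*} {ι : Type*} [Fintype ι]
variable (T : ι → Equiv.Perm S) (U : ι → S → 𝔸ˣ)

/-- **(3.50), LAST LINE**, for the product configuration `U′U`, `U′ = e^{iηA}`: every transport of the star form is a conjugated
background transport — forward `exp iηad_{A_μ(x)}·R(U_μ(x))λ(x+e_μ) = e^{iηA_μ(x)}R(U_μ(x))λ(x+e_μ)e^{−iηA_μ(x)}`, backward
`e^{−a′}R(U_μ(y))⁻¹λ(y)e^{a′}`, `y = x − e_μ`, `a′ = R(U_μ(y))⁻¹(iηA_μ(y))` (the print's `exp iηad_{A′(b)}R(U_b)λ(b₊)` with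
`A′(b) = R(U_b)A(b)`, `A(b) = −A_μ(y)`).  [cite: Balaban1985BackgroundPropagators, (3.50) p.400] -/
theorem siteLap_prodCfg (η : ℝ) (A : ι → S → 𝔸) (lam : S → 𝔸) (x : S) :
    siteLap T (prodCfg U η A) η lam x
      = (((η : ℂ)⁻¹) ^ 2) • ∑ μ, (2 • lam x
          - exp (((I * η : ℂ)) • A μ x) * R (U μ x) (lam (T μ x)) * exp (-(((I * η : ℂ)) • A μ x))
          - exp (-(R (U μ ((T μ).symm x))⁻¹ (((I * η : ℂ)) • A μ ((T μ).symm x))))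
              * R (U μ ((T μ).symm x))⁻¹ (lam ((T μ).symm x))
              * exp (R (U μ ((T μ).symm x))⁻¹ (((I * η : ℂ)) • A μ ((T μ).symm x)))) := by
  rw [siteLap_eq_star]
  congr 1
  refine Finset.sum_congr rfl fun μ _ => ?_
  have hf : R (prodCfg U η A μ x) (lam (T μ x))
      = exp (((I * η : ℂ)) • A μ x) * R (U μ x) (lam (T μ x)) * exp (-(((I * η : ℂ)) • A μ x)) := by
    simp only [prodCfg, B9Eq39Adjoint.R_mul, R_fluct]
  rw [hf, R_inv_prodCfg, R_conj_exp]

/-- The print's remainder operator applied: `F′_{1,k}(iad_a)Y` with `F′_{1,k}(z) = η⁻²(e^{ηz} − 1 − ηz)` IS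
`η⁻²·𝓕(iηa, Y)`, `𝓕(b, Y) = e^{b}Ye^{−b} − Y − [b, Y]` (`…B9Eq370Expansion.conjRem`) — since `exp(iηad_a)Y = e^{iηa}Ye^{−iηa}`.
[cite: Balaban1985BackgroundPropagators, (3.51) p.400] -/
noncomputable def Fp1 (η : ℝ) (a Y : 𝔸) : 𝔸 := (((η : ℂ)⁻¹) ^ 2) • conjRem (((I * η : ℂ)) • a) Y

omit [CompleteSpace 𝔸] in
/-- Unfolding `Fp1`. [cite: Balaban1985BackgroundPropagators, (3.51) p.400] -/
theorem Fp1_eq (η : ℝ) (a Y : 𝔸) : Fp1 η a Y = (((η : ℂ)⁻¹) ^ 2) • conjRem (((I * η : ℂ)) • a) Y := rfl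

/-- **`V′₁(A)`**, the operator DEFINED by (3.53) `Δ_{U′U} = Δ_U − V′₁(A)` and written out as in (3.50)–(3.51): per direction,
the forward bond contributes `η⁻²(iη[A_μ(x), Y] + 𝓕(iηA_μ(x), Y))`, `Y = R(U_μ(x))λ(x+e_μ)`, and the backward bond
`η⁻²(−iη[a′₀, W] + 𝓕(−iηa′₀, W))`, `a′₀ = R(U_μ(y))⁻¹A_μ(y)`, `W = R(U_μ(y))⁻¹λ(y)`, `y = x − e_μ` (the print's letters:
`A′(b) = −a′₀`, `R(U_b)λ(b₊) = W` on the backward bond).  Its first-order part regrouped as printed is `V1p_eq_firstOrder`.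
[cite: Balaban1985BackgroundPropagators, (3.51)–(3.53) p.400] -/
noncomputable def V1p (η : ℝ) (A : ι → S → 𝔸) (lam : S → 𝔸) (x : S) : 𝔸 :=
  (((η : ℂ)⁻¹) ^ 2) • ∑ μ,
    (ad (((I * η : ℂ)) • A μ x) (R (U μ x) (lam (T μ x)))
      + conjRem (((I * η : ℂ)) • A μ x) (R (U μ x) (lam (T μ x)))
      - ad (((I * η : ℂ)) • R (U μ ((T μ).symm x))⁻¹ (A μ ((T μ).symm x)))
          (R (U μ ((T μ).symm x))⁻¹ (lam ((T μ).symm x)))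
      + conjRem (-(((I * η : ℂ)) • R (U μ ((T μ).symm x))⁻¹ (A μ ((T μ).symm x))))
          (R (U μ ((T μ).symm x))⁻¹ (lam ((T μ).symm x))))

/-- **(3.53)**, EXACTLY: `Δ_{U′U} = Δ_U − V′₁(A)` on site functions («Expanding the exponential above we get … (3.51) … and
Δ_{U′U} = Δ_U − V′₁(A). (3.53)»).  [cite: Balaban1985BackgroundPropagators, (3.53) p.400, (3.50)–(3.51) p.400] -/
theorem eq353 (η : ℝ) (A : ι → S → 𝔸) (lam : S → 𝔸) (x : S) :
    siteLap T (prodCfg U η A) η lam x = siteLap T U η lam x - V1p T U η A lam x := by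
  rw [siteLap_prodCfg, siteLap_eq_star, V1p, ← smul_sub, ← Finset.sum_sub_distrib]
  congr 1
  refine Finset.sum_congr rfl fun μ _ => ?_
  rw [R_Iη_smul, conj_eq_expand (((I * η : ℂ)) • A μ x) (R (U μ x) (lam (T μ x)))]
  have hb := conj_eq_expand (-(((I * η : ℂ)) • R (U μ ((T μ).symm x))⁻¹ (A μ ((T μ).symm x))))
    (R (U μ ((T μ).symm x))⁻¹ (lam ((T μ).symm x)))
  rw [neg_neg] at hb
  rw [hb, ad_neg_left]
  abel

omit [NormedAlgebra ℂ 𝔸] [CompleteSpace 𝔸] [Fintype ι] in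
/-- `R(U_μ(x))λ(x+e_μ) = (D¹_μλ)(x) + λ(x)` — the transported neighbour through the forward difference (3.3) (the definition
(3.3) rearranged). [cite: Balaban1985BackgroundPropagators, (3.3) p.390] -/
theorem transport_fwd_eq (μ : ι) (lam : S → 𝔸) (x : S) :
    R (U μ x) (lam (T μ x)) = covD T U μ lam x + lam x := by
  simp only [covD, sub_add_cancel]

omit [NormedAlgebra ℂ 𝔸] [CompleteSpace 𝔸] [Fintype ι] in
/-- `R(U_μ(y))⁻¹λ(y) = (D¹*_μλ)(x) + λ(x)`, `y = x − e_μ` — the transported neighbour through the backward difference, which is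
(3.3) along the reversed bond `⟨x, x−e_μ⟩` («= Σ(DA_μ)(x, x−ηe_μ)», (3.8)) (the definition rearranged).
[cite: Balaban1985BackgroundPropagators, (3.8) p.392, (3.3) p.390] -/
theorem transport_bwd_eq (μ : ι) (lam : S → 𝔸) (x : S) :
    R (U μ ((T μ).symm x))⁻¹ (lam ((T μ).symm x)) = covDstar T U μ lam x + lam x := by
  simp only [covDstar, sub_add_cancel]

/-- The scalar arithmetic of the regrouping: `η⁻²·(iη) = i·η⁻¹` (`η ≠ 0`) — elementary API for the first-order form of (3.52).
[folklore] [cite: Balaban1985BackgroundPropagators, (3.52) p.400] -/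
private theorem inv_sq_mul_I_mul (η : ℝ) (hη : η ≠ 0) : ((η : ℂ)⁻¹) ^ 2 * (I * η) = I * (η : ℂ)⁻¹ := by
  have hη' : (η : ℂ) ≠ 0 := Complex.ofReal_ne_zero.mpr hη
  field_simp

omit [CompleteSpace 𝔸] in
/-- **(3.50) → (3.51)/(3.52): the first-order part of `V′₁(A)` REGROUPED AS PRINTED**, exactly (`η ≠ 0`):
`(V′₁(A)λ)(x) = Σ_{b∈st(x)} i[A′(b), (D_Uλ)(b)] − i[(D*_U A)(x), λ(x)] + Σ_{b∈st(x)} F′_{1,k}(iad_{A′(b)})R(U_b)λ(b₊)` with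
`(D_Uλ)(b) = η⁻¹(D¹_μλ)(x)` on the forward bond and `= η⁻¹(D¹*_μλ)(x)` on the backward bond `⟨x, x−e_μ⟩` (there `A′(b) =
−R(U_μ(y))⁻¹A_μ(y)`), and `(D*_U A)(x) = η⁻¹·divB A x` = (3.8).  See the module docstring (READING NOTE) for the sign of the
middle commutator against the print.  [cite: Balaban1985BackgroundPropagators, (3.51)–(3.52) p.400, (3.8) p.392] -/
theorem V1p_eq_firstOrder (η : ℝ) (hη : η ≠ 0) (A : ι → S → 𝔸) (lam : S → 𝔸) (x : S) :
    V1p T U η A lam x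
      = (∑ μ, ((I : ℂ) • ad (A μ x) (((η : ℂ)⁻¹) • covD T U μ lam x)
          - (I : ℂ) • ad (R (U μ ((T μ).symm x))⁻¹ (A μ ((T μ).symm x))) (((η : ℂ)⁻¹) • covDstar T U μ lam x)))
        - (I : ℂ) • ad (((η : ℂ)⁻¹) • divB T U A x) (lam x)
        + ∑ μ, (Fp1 η (A μ x) (R (U μ x) (lam (T μ x)))
          + Fp1 η (-(R (U μ ((T μ).symm x))⁻¹ (A μ ((T μ).symm x)))) (R (U μ ((T μ).symm x))⁻¹ (lam ((T μ).symm x)))) := by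
  -- abbreviations
  set c : ℂ := (η : ℂ)⁻¹ with hc
  have hcI : c ^ 2 * (I * η) = I * c := by rw [hc]; exact inv_sq_mul_I_mul η hη
  -- the forward first-order term, per direction
  have hfwd : ∀ μ, (c ^ 2) • ad (((I * η : ℂ)) • A μ x) (R (U μ x) (lam (T μ x)))
      = (I : ℂ) • ad (A μ x) (c • covD T U μ lam x) + (I * c) • ad (A μ x) (lam x) := by
    intro μ
    rw [transport_fwd_eq T U μ lam x, ad_smul_left, smul_smul, hcI, ad_add_right, smul_add, ad_smul_right, smul_smul]
  -- the backward first-order term, per direction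
  have hbwd : ∀ μ, (c ^ 2) • ad (((I * η : ℂ)) • R (U μ ((T μ).symm x))⁻¹ (A μ ((T μ).symm x)))
        (R (U μ ((T μ).symm x))⁻¹ (lam ((T μ).symm x)))
      = (I : ℂ) • ad (R (U μ ((T μ).symm x))⁻¹ (A μ ((T μ).symm x))) (c • covDstar T U μ lam x)
        + (I * c) • ad (R (U μ ((T μ).symm x))⁻¹ (A μ ((T μ).symm x))) (lam x) := by
    intro μ
    rw [transport_bwd_eq T U μ lam x, ad_smul_left, smul_smul, hcI, ad_add_right, smul_add, ad_smul_right, smul_smul]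
  -- the remainders, per direction
  have hrem : ∀ μ, (c ^ 2) • (conjRem (((I * η : ℂ)) • A μ x) (R (U μ x) (lam (T μ x)))
        + conjRem (-(((I * η : ℂ)) • R (U μ ((T μ).symm x))⁻¹ (A μ ((T μ).symm x))))
          (R (U μ ((T μ).symm x))⁻¹ (lam ((T μ).symm x))))
      = Fp1 η (A μ x) (R (U μ x) (lam (T μ x)))
        + Fp1 η (-(R (U μ ((T μ).symm x))⁻¹ (A μ ((T μ).symm x)))) (R (U μ ((T μ).symm x))⁻¹ (lam ((T μ).symm x))) := by
    intro μ
    rw [Fp1_eq, Fp1_eq, smul_neg, smul_add]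
  -- the divergence term: `Σ_μ (A_μ(x) − a′₀μ) = −divB A x`
  have hdiv : ∑ μ, ((I * c) • ad (A μ x) (lam x) - (I * c) • ad (R (U μ ((T μ).symm x))⁻¹ (A μ ((T μ).symm x))) (lam x))
      = -((I : ℂ) • ad (c • divB T U A x) (lam x)) := by
    rw [ad_smul_left, smul_smul]
    have h1 : ∀ μ, (I * c) • ad (A μ x) (lam x) - (I * c) • ad (R (U μ ((T μ).symm x))⁻¹ (A μ ((T μ).symm x))) (lam x)
        = (I * c) • ad (A μ x - R (U μ ((T μ).symm x))⁻¹ (A μ ((T μ).symm x))) (lam x) := by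
      intro μ; rw [ad_sub_left, smul_sub]
    simp only [h1, ← Finset.smul_sum]
    rw [← smul_neg]
    congr 1
    have h2 : ∑ μ, ad (A μ x - R (U μ ((T μ).symm x))⁻¹ (A μ ((T μ).symm x))) (lam x)
        = ad (∑ μ, (A μ x - R (U μ ((T μ).symm x))⁻¹ (A μ ((T μ).symm x)))) (lam x) := by
      conv_rhs => rw [Beta.BackgroundVertices.ad_apply, Finset.sum_mul, Finset.mul_sum, ← Finset.sum_sub_distrib]
      simp only [Beta.BackgroundVertices.ad_apply]
    rw [h2, ← ad_neg_left]
    congr 1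
    simp only [divB, covDstar, Finset.sum_sub_distrib, neg_sub]
  -- assemble
  unfold V1p
  rw [← hc, Finset.smul_sum]
  have hsplit : ∀ μ, (c ^ 2) • (ad (((I * η : ℂ)) • A μ x) (R (U μ x) (lam (T μ x)))
        + conjRem (((I * η : ℂ)) • A μ x) (R (U μ x) (lam (T μ x)))
        - ad (((I * η : ℂ)) • R (U μ ((T μ).symm x))⁻¹ (A μ ((T μ).symm x)))
            (R (U μ ((T μ).symm x))⁻¹ (lam ((T μ).symm x)))
        + conjRem (-(((I * η : ℂ)) • R (U μ ((T μ).symm x))⁻¹ (A μ ((T μ).symm x))))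
            (R (U μ ((T μ).symm x))⁻¹ (lam ((T μ).symm x))))
      = (((I : ℂ) • ad (A μ x) (c • covD T U μ lam x)
            - (I : ℂ) • ad (R (U μ ((T μ).symm x))⁻¹ (A μ ((T μ).symm x))) (c • covDstar T U μ lam x))
          + ((I * c) • ad (A μ x) (lam x)
            - (I * c) • ad (R (U μ ((T μ).symm x))⁻¹ (A μ ((T μ).symm x))) (lam x)))
          + (Fp1 η (A μ x) (R (U μ x) (lam (T μ x)))
            + Fp1 η (-(R (U μ ((T μ).symm x))⁻¹ (A μ ((T μ).symm x))))
                (R (U μ ((T μ).symm x))⁻¹ (lam ((T μ).symm x)))) := by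
    intro μ
    rw [← hrem μ]
    have e1 := hfwd μ
    have e2 := hbwd μ
    rw [show ∀ (p q r s : 𝔸), (c ^ 2) • (p + q - r + s) = (c ^ 2) • p + (c ^ 2) • (q + s) - (c ^ 2) • r from
      fun p q r s => by simp only [smul_add, smul_sub]; abel, e1, e2]
    abel
  simp only [hsplit, Finset.sum_add_distrib]
  rw [hdiv]
  abel

end Fluct

/-! ## §3  The bound (3.54) -/

section Bound

variable {𝔸 : Type*} [NormedRing 𝔸] [NormedAlgebra ℂ 𝔸] [CompleteSpace 𝔸] {S : Type*} {ι : Type*} [Fintype ι]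
variable (T : ι → Equiv.Perm S) (U : ι → S → 𝔸ˣ)

omit [CompleteSpace 𝔸] in
/-- `‖i·X‖ = ‖X‖` — elementary API for the bound (3.54). [folklore] [cite: Balaban1985BackgroundPropagators, (3.54) p.401] -/
private theorem norm_I_smul (X : 𝔸) : ‖(I : ℂ) • X‖ = ‖X‖ := by
  rw [norm_smul, Complex.norm_I, one_mul]

/-- The remainder of ONE transport in the print's normalisation: `‖F′_{1,k}(iad_a)Y‖ = η⁻²‖𝓕(iηa, Y)‖ ≤ 2‖a‖²e^{2η‖a‖}‖Y‖`
(`…B9Eq370Expansion.norm_conjRem_le_sq`).  [cite: Balaban1985BackgroundPropagators, (3.51) p.400, (3.54) p.401] -/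
theorem norm_Fp1_le {η : ℝ} (hη : 0 < η) (a Y : 𝔸) :
    ‖Fp1 η a Y‖ ≤ 2 * ‖a‖ ^ 2 * Real.exp (2 * (η * ‖a‖)) * ‖Y‖ := by
  rw [Fp1_eq, norm_smul]
  have h := norm_conjRem_le_sq (((I * η : ℂ)) • a) Y
  rw [norm_Iη_smul hη.le] at h
  have hc : ‖((η : ℂ)⁻¹) ^ 2‖ = (η ^ 2)⁻¹ := by
    rw [norm_pow, norm_inv, Complex.norm_real, Real.norm_eq_abs, abs_of_pos hη, inv_pow]
  rw [hc]
  calc (η ^ 2)⁻¹ * ‖conjRem (((I * η : ℂ)) • a) Y‖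
      ≤ (η ^ 2)⁻¹ * (2 * (η * ‖a‖) ^ 2 * Real.exp (2 * (η * ‖a‖)) * ‖Y‖) :=
        mul_le_mul_of_nonneg_left h (by positivity)
    _ = 2 * ‖a‖ ^ 2 * Real.exp (2 * (η * ‖a‖)) * ‖Y‖ := by
        field_simp

omit [NormedAlgebra ℂ 𝔸] [CompleteSpace 𝔸] in
/-- Monotonicity of the remainder constant in the letter size: `‖a‖ ≤ s ⟹ 2‖a‖²e^{2η‖a‖}‖Y‖ ≤ 2s²e^{2ηs}‖Y‖` (`η ≥ 0`) —
elementary API for the bound (3.54). [folklore] [cite: Balaban1985BackgroundPropagators, (3.54) p.401] -/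
private theorem rem_const_mono {η s : ℝ} (hη : 0 ≤ η) {a Y : 𝔸} (ha : ‖a‖ ≤ s) :
    2 * ‖a‖ ^ 2 * Real.exp (2 * (η * ‖a‖)) * ‖Y‖ ≤ 2 * s ^ 2 * Real.exp (2 * (η * s)) * ‖Y‖ := by
  have h0 : 0 ≤ ‖a‖ := norm_nonneg a
  have h1 : ‖a‖ ^ 2 ≤ s ^ 2 := pow_le_pow_left₀ h0 ha 2
  have h2 : Real.exp (2 * (η * ‖a‖)) ≤ Real.exp (2 * (η * s)) :=
    Real.exp_le_exp.mpr (by nlinarith)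
  have h3 : 0 ≤ Real.exp (2 * (η * ‖a‖)) := (Real.exp_pos _).le
  gcongr

/-- **(3.54) WITH EXPLICIT CONSTANTS, from local hypotheses at the star of `x`.**  Letters as they occur in (3.52): on each
of the `2d` bonds `b ∈ st(x)` the transported fluctuation letter `A′(b)` (`A_μ(x)` forward, `R(U_μ(y))⁻¹A_μ(y)` backward) has
`‖A′(b)‖ ≤ a`, the covariant derivative `(D_Uλ)(b)` (`η⁻¹D¹_μλ(x)`, resp. `η⁻¹D¹*_μλ(x)`) has norm `≤ Λ₁`, `‖(D*_U A)(x)‖ ≤ g`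
(`D* = η⁻¹·divB`, (3.8)), and `λ(x)` and the transported neighbour values `R(U_b)λ(b₊)` have norm `≤ Λ₀`.  Then
`‖(V′₁(A)λ)(x)‖ ≤ 4d·a·Λ₁ + 2·g·Λ₀ + 4d·a²e^{2ηa}·Λ₀` (`d = card ι`).  For a unitary background in an operator norm the transports
are isometries and the hypotheses are the print's `|A| ≤ a`, `|∇_Uλ| ≤ Λ₁`, `|λ| ≤ Λ₀` over the nearest neighbours («the norms on
the right-hand side involve only nearest neighbours of x because V′₁ is local»).
[cite: Balaban1985BackgroundPropagators, (3.54) p.401, (3.52) p.400] -/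
theorem norm_V1p_le {η : ℝ} (hη : 0 < η) (A : ι → S → 𝔸) (lam : S → 𝔸) (x : S) {a g Λ₀ Λ₁ : ℝ}
    (ha : 0 ≤ a)
    (hA : ∀ μ, ‖A μ x‖ ≤ a ∧ ‖R (U μ ((T μ).symm x))⁻¹ (A μ ((T μ).symm x))‖ ≤ a)
    (hD : ∀ μ, ‖((η : ℂ)⁻¹) • covD T U μ lam x‖ ≤ Λ₁ ∧ ‖((η : ℂ)⁻¹) • covDstar T U μ lam x‖ ≤ Λ₁)
    (hg : ‖((η : ℂ)⁻¹) • divB T U A x‖ ≤ g)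
    (hl : ‖lam x‖ ≤ Λ₀)
    (hY : ∀ μ, ‖R (U μ x) (lam (T μ x))‖ ≤ Λ₀ ∧ ‖R (U μ ((T μ).symm x))⁻¹ (lam ((T μ).symm x))‖ ≤ Λ₀) :
    ‖V1p T U η A lam x‖
      ≤ 4 * Fintype.card ι * a * Λ₁ + 2 * g * Λ₀
        + 4 * Fintype.card ι * a ^ 2 * Real.exp (2 * (η * a)) * Λ₀ := by
  have hΛ₀ : 0 ≤ Λ₀ := (norm_nonneg _).trans hl
  rw [V1p_eq_firstOrder T U η hη.ne' A lam x]
  -- first-order star terms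
  have h1 : ∀ μ, ‖(I : ℂ) • ad (A μ x) (((η : ℂ)⁻¹) • covD T U μ lam x)
      - (I : ℂ) • ad (R (U μ ((T μ).symm x))⁻¹ (A μ ((T μ).symm x))) (((η : ℂ)⁻¹) • covDstar T U μ lam x)‖
      ≤ 2 * a * Λ₁ + 2 * a * Λ₁ := by
    intro μ
    refine (norm_sub_le _ _).trans (add_le_add ?_ ?_)
    · rw [norm_I_smul]
      refine (norm_ad_le _ _).trans ?_
      have := (hA μ).1; have := (hD μ).1
      gcongr
    · rw [norm_I_smul]
      refine (norm_ad_le _ _).trans ?_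
      have := (hA μ).2; have := (hD μ).2
      gcongr
  have hS1 : ‖∑ μ, ((I : ℂ) • ad (A μ x) (((η : ℂ)⁻¹) • covD T U μ lam x)
      - (I : ℂ) • ad (R (U μ ((T μ).symm x))⁻¹ (A μ ((T μ).symm x))) (((η : ℂ)⁻¹) • covDstar T U μ lam x))‖
      ≤ 4 * Fintype.card ι * a * Λ₁ := by
    refine (norm_sum_le _ _).trans ?_
    calc ∑ μ, ‖(I : ℂ) • ad (A μ x) (((η : ℂ)⁻¹) • covD T U μ lam x)
          - (I : ℂ) • ad (R (U μ ((T μ).symm x))⁻¹ (A μ ((T μ).symm x))) (((η : ℂ)⁻¹) • covDstar T U μ lam x)‖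
        ≤ ∑ _μ : ι, (2 * a * Λ₁ + 2 * a * Λ₁) := Finset.sum_le_sum fun μ _ => h1 μ
      _ = 4 * Fintype.card ι * a * Λ₁ := by
          rw [Finset.sum_const, Finset.card_univ, nsmul_eq_mul]; ring
  -- the divergence commutator
  have hS2 : ‖(I : ℂ) • ad (((η : ℂ)⁻¹) • divB T U A x) (lam x)‖ ≤ 2 * g * Λ₀ := by
    rw [norm_I_smul]
    refine (norm_ad_le _ _).trans ?_
    have hg0 : 0 ≤ g := (norm_nonneg _).trans hg
    gcongr
  -- the remainders
  have h3 : ∀ μ, ‖Fp1 η (A μ x) (R (U μ x) (lam (T μ x)))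
      + Fp1 η (-(R (U μ ((T μ).symm x))⁻¹ (A μ ((T μ).symm x)))) (R (U μ ((T μ).symm x))⁻¹ (lam ((T μ).symm x)))‖
      ≤ 2 * a ^ 2 * Real.exp (2 * (η * a)) * Λ₀ + 2 * a ^ 2 * Real.exp (2 * (η * a)) * Λ₀ := by
    intro μ
    have hE : 0 ≤ 2 * a ^ 2 * Real.exp (2 * (η * a)) := by positivity
    refine (norm_add_le _ _).trans (add_le_add ?_ ?_)
    · refine (norm_Fp1_le hη _ _).trans ?_
      refine (rem_const_mono hη.le (hA μ).1).trans ?_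
      exact mul_le_mul_of_nonneg_left (hY μ).1 hE
    · refine (norm_Fp1_le hη _ _).trans ?_
      have ha' : ‖-(R (U μ ((T μ).symm x))⁻¹ (A μ ((T μ).symm x)))‖ ≤ a := by rw [norm_neg]; exact (hA μ).2
      refine (rem_const_mono hη.le ha').trans ?_
      exact mul_le_mul_of_nonneg_left (hY μ).2 hE
  have hS3 : ‖∑ μ, (Fp1 η (A μ x) (R (U μ x) (lam (T μ x)))
      + Fp1 η (-(R (U μ ((T μ).symm x))⁻¹ (A μ ((T μ).symm x)))) (R (U μ ((T μ).symm x))⁻¹ (lam ((T μ).symm x))))‖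
      ≤ 4 * Fintype.card ι * a ^ 2 * Real.exp (2 * (η * a)) * Λ₀ := by
    refine (norm_sum_le _ _).trans ?_
    calc ∑ μ, ‖Fp1 η (A μ x) (R (U μ x) (lam (T μ x)))
          + Fp1 η (-(R (U μ ((T μ).symm x))⁻¹ (A μ ((T μ).symm x)))) (R (U μ ((T μ).symm x))⁻¹ (lam ((T μ).symm x)))‖
        ≤ ∑ _μ : ι, (2 * a ^ 2 * Real.exp (2 * (η * a)) * Λ₀ + 2 * a ^ 2 * Real.exp (2 * (η * a)) * Λ₀) :=
          Finset.sum_le_sum fun μ _ => h3 μ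
      _ = 4 * Fintype.card ι * a ^ 2 * Real.exp (2 * (η * a)) * Λ₀ := by
          rw [Finset.sum_const, Finset.card_univ, nsmul_eq_mul]; ring
  calc ‖(∑ μ, ((I : ℂ) • ad (A μ x) (((η : ℂ)⁻¹) • covD T U μ lam x)
          - (I : ℂ) • ad (R (U μ ((T μ).symm x))⁻¹ (A μ ((T μ).symm x))) (((η : ℂ)⁻¹) • covDstar T U μ lam x)))
        - (I : ℂ) • ad (((η : ℂ)⁻¹) • divB T U A x) (lam x)
        + ∑ μ, (Fp1 η (A μ x) (R (U μ x) (lam (T μ x)))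
          + Fp1 η (-(R (U μ ((T μ).symm x))⁻¹ (A μ ((T μ).symm x)))) (R (U μ ((T μ).symm x))⁻¹ (lam ((T μ).symm x))))‖
      ≤ ‖∑ μ, ((I : ℂ) • ad (A μ x) (((η : ℂ)⁻¹) • covD T U μ lam x)
          - (I : ℂ) • ad (R (U μ ((T μ).symm x))⁻¹ (A μ ((T μ).symm x))) (((η : ℂ)⁻¹) • covDstar T U μ lam x))‖
        + ‖(I : ℂ) • ad (((η : ℂ)⁻¹) • divB T U A x) (lam x)‖
        + ‖∑ μ, (Fp1 η (A μ x) (R (U μ x) (lam (T μ x)))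
          + Fp1 η (-(R (U μ ((T μ).symm x))⁻¹ (A μ ((T μ).symm x)))) (R (U μ ((T μ).symm x))⁻¹ (lam ((T μ).symm x))))‖ :=
        (norm_add_le _ _).trans (add_le_add (norm_sub_le _ _) le_rfl)
    _ ≤ 4 * Fintype.card ι * a * Λ₁ + 2 * g * Λ₀ + 4 * Fintype.card ι * a ^ 2 * Real.exp (2 * (η * a)) * Λ₀ :=
        add_le_add_three hS1 hS2 hS3

/-- «for α₁ sufficiently small» of (3.54), located as a number: `ηa ≤ 1/4 ⟹ e^{2ηa} ≤ 2` (since `e^{1/2} ≤ 2 ⟸ e < 4`) — the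
smallness under which the remainder constant `4d·a²e^{2ηa}` is the printed `8dα₁²(L^jη)⁻²`. [folklore]
[cite: Balaban1985BackgroundPropagators, (3.54) p.401] -/
theorem exp_two_mul_le_two {t : ℝ} (ht : t ≤ 1 / 4) : Real.exp (2 * t) ≤ 2 := by
  have h1 : Real.exp (2 * t) ≤ Real.exp (1 / 2) := Real.exp_le_exp.mpr (by linarith)
  have h2 : Real.exp (1 / 2) ≤ 2 := by
    have hsq : Real.exp (1 / 2) * Real.exp (1 / 2) = Real.exp 1 := by
      rw [← Real.exp_add]; norm_num
    have he : Real.exp 1 < 4 := lt_trans Real.exp_one_lt_d9 (by norm_num)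
    nlinarith [Real.exp_pos (1 / 2 : ℝ)]
  exact h1.trans h2

/-- **(3.54) IN THE PRINTED SHAPE.**  With the scale `s = L^jη > 0` of the block containing `x`, the hypotheses of (3.37) read
on the star of `x` — `‖A′(b)‖ ≤ α₁s⁻¹` and `‖(D*_U A)(x)‖ ≤ d·α₁s⁻²` (`D*A` is a sum of `d` covariant derivatives of `A`, each
`< α₁(L^jη)⁻²`) — and `α₁s⁻¹·η ≤ 1/4` («for α₁ sufficiently small»: `e^{2α₁L^{−j}} ≤ 2`):
`‖(V′₁(A)λ)(x)‖ ≤ 4dα₁(L^jη)⁻¹Λ₁ + 2dα₁(L^jη)⁻²Λ₀ + 8dα₁²(L^jη)⁻²Λ₀` — (3.54) with `Λ₁ = |∇_Uλ|`, `Λ₀ = |λ|` over the nearest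
neighbours of `x`.  [cite: Balaban1985BackgroundPropagators, (3.54) p.401, (3.37) p.396] -/
theorem norm_V1p_le_printed {η : ℝ} (hη : 0 < η) (A : ι → S → 𝔸) (lam : S → 𝔸) (x : S) {α₁ s Λ₀ Λ₁ : ℝ}
    (hα : 0 ≤ α₁) (hs : 0 < s) (hsmall : η * (α₁ * s⁻¹) ≤ 1 / 4)
    (hA : ∀ μ, ‖A μ x‖ ≤ α₁ * s⁻¹ ∧ ‖R (U μ ((T μ).symm x))⁻¹ (A μ ((T μ).symm x))‖ ≤ α₁ * s⁻¹)
    (hD : ∀ μ, ‖((η : ℂ)⁻¹) • covD T U μ lam x‖ ≤ Λ₁ ∧ ‖((η : ℂ)⁻¹) • covDstar T U μ lam x‖ ≤ Λ₁)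
    (hg : ‖((η : ℂ)⁻¹) • divB T U A x‖ ≤ Fintype.card ι * (α₁ * (s⁻¹) ^ 2))
    (hl : ‖lam x‖ ≤ Λ₀)
    (hY : ∀ μ, ‖R (U μ x) (lam (T μ x))‖ ≤ Λ₀ ∧ ‖R (U μ ((T μ).symm x))⁻¹ (lam ((T μ).symm x))‖ ≤ Λ₀) :
    ‖V1p T U η A lam x‖
      ≤ 4 * Fintype.card ι * α₁ * s⁻¹ * Λ₁ + 2 * Fintype.card ι * α₁ * (s⁻¹) ^ 2 * Λ₀
        + 8 * Fintype.card ι * α₁ ^ 2 * (s⁻¹) ^ 2 * Λ₀ := by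
  have ha : 0 ≤ α₁ * s⁻¹ := mul_nonneg hα (inv_nonneg.mpr hs.le)
  have hΛ₀ : 0 ≤ Λ₀ := (norm_nonneg _).trans hl
  have h := norm_V1p_le T U hη A lam x ha hA hD hg hl hY
  have he : Real.exp (2 * (η * (α₁ * s⁻¹))) ≤ 2 := exp_two_mul_le_two hsmall
  have hd : (0 : ℝ) ≤ Fintype.card ι := Nat.cast_nonneg _
  calc ‖V1p T U η A lam x‖
      ≤ 4 * Fintype.card ι * (α₁ * s⁻¹) * Λ₁ + 2 * (Fintype.card ι * (α₁ * (s⁻¹) ^ 2)) * Λ₀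
        + 4 * Fintype.card ι * (α₁ * s⁻¹) ^ 2 * Real.exp (2 * (η * (α₁ * s⁻¹))) * Λ₀ := h
    _ ≤ 4 * Fintype.card ι * (α₁ * s⁻¹) * Λ₁ + 2 * (Fintype.card ι * (α₁ * (s⁻¹) ^ 2)) * Λ₀
        + 4 * Fintype.card ι * (α₁ * s⁻¹) ^ 2 * 2 * Λ₀ := by
          have h4 : 0 ≤ 4 * Fintype.card ι * (α₁ * s⁻¹) ^ 2 := by positivity
          have := mul_le_mul_of_nonneg_left he h4
          nlinarith
    _ = 4 * Fintype.card ι * α₁ * s⁻¹ * Λ₁ + 2 * Fintype.card ι * α₁ * (s⁻¹) ^ 2 * Λ₀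
        + 8 * Fintype.card ι * α₁ ^ 2 * (s⁻¹) ^ 2 * Λ₀ := by ring

end Bound

/-! ## §4  Sanity -/

section Examples

variable {𝔸 : Type*} [NormedRing 𝔸] [NormedAlgebra ℂ 𝔸] [CompleteSpace 𝔸] {S : Type*} {ι : Type*} [Fintype ι]
variable (T : ι → Equiv.Perm S) (U : ι → S → 𝔸ˣ)

/-- No fluctuation field, no correction: `V′₁(0) = 0` ((3.53) with `U′ = 1`). [folklore] -/
example (η : ℝ) (lam : S → 𝔸) (x : S) : V1p T U η (0 : ι → S → 𝔸) lam x = 0 := by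
  simp [V1p, conjRem, Beta.BackgroundVertices.ad_apply]

/-- … hence `Δ_{U′U} = Δ_U` at `A = 0`. [folklore] -/
example (η : ℝ) (lam : S → 𝔸) (x : S) : siteLap T (prodCfg U η (0 : ι → S → 𝔸)) η lam x = siteLap T U η lam x := by
  rw [prodCfg_zero]

end Examples

end Literature.MathematicalPhysics.QuantumFieldTheory.Balaban1983to89.B9Eq352ScalarFluct
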